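import Summits.QuantumFields.YangMills.Theorems.UnitScaleTiltProp7OneFormKatoBootstrapDecay
import Summits.QuantumFields.YangMills.Theorems.UnitScaleTiltProp7OneFormDecayLetters
import HarnessLib

/-!
# Route `UnitScaleTilt`, crux K1 «MinimiserStabilityRegPr» (stmt-QuantumFields-19200), EX face S45 — (L3′b), ONE-FORM STOREY, FILE O4:
# **THE POINTWISE EXPONENTIAL DECAY OF THE ONE-FORM GREEN's FUNCTION, ASSEMBLED (the weighted-sup fixpoint)** — print's (3.42)∕Thm 3.12 first entry WITH its factor
# `e^{−δ₀·d(b, supp f)}` for `u = Δ_a(U₀)⁻¹f`, from cst-p1 g35's (O3d) ✓`norm_apply_le_of_kato_oneForm_weighted_of_letter` (V3's bond twin) run at EVERY bond against a family of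
# supersolution weights, with the data letters in DECAYED form and the local `O(ε₀)` stencil part absorbed by the fixpoint of O4a ✓`ciSup_le_div_of_forall_le_add_mul`

Cell `ym3-torus` (HUMAN RULING D-0037; rung R3 = SU(2) YM₃ on T³ — NOT d = 4, NOT infinite volume, NOT a mass gap, NOT Clay).  Chair seat ★`ym-ust-19200-p1` g26, own pen O4.
THEOREMS ONLY (0 `def`, 0 `sorry`, default heartbeats); `--supports stmt-QuantumFields-19200 --as helper`; count-neutral.

THE ARGUMENT.  Fix a «distance to the source» `d : Bond → ℝ` and a rate `κ`.  For each evaluation bond `p₁` take a weight `W p₁ ·` (positive, normalised `W p₁ p₁ = 1`, a `λ`-supersolution of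
the flat bond stencil — V4b-1 ✓`Prop7MemberCoshWeight` supplies the cosh product) with the GROWTH letter `e^{κ d(p₁)} ≤ C_g·e^{κ d(p)}·W p₁ p` (triangle inequality for the cosh weight).
If the data are DECAYED — `‖f(p)‖ ≤ F·e^{−κd(p)}` (block support), `‖q(p)‖ ≤ (s_D + θ·S)·e^{−κd(p)}` with `S := sup_p ‖u(p)‖e^{κd(p)}` (the non-local remainder pieces (D)(Q)(X) through
their kernel decay and A4's block decay give `s_D`; the LOCAL stencil piece `η⁻²(Δ′₁ − 𝒦)` gives `θ = 32√2ε₀·e^{κ}`), and `√(Σ c₀‖u‖²∕W p₁) ≤ E_W·e^{−κd(p₁)}` (O4a ✓`sum_normSq_div_weight_le_of_blocks`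
+ A4 ✓`blockDecay_oneForm_of_letters`) — then (O3d) at `p₁` reads `‖u(p₁)‖e^{κd(p₁)} ≤ A + θ′·S`, and the fixpoint gives `S ≤ A∕(1 − θ′)`, i.e. POINTWISE DECAY at every bond.
WHAT IS PROVED (ns `Summit.QuantumFields.YangMills.Theorems.Prop7OneFormPointwiseDecay`).
* ★★★ `pointwiseDecay_oneForm_of_letters` — for EVERY background `U₀`, slot `Δx`, coupling `a`, every `u f` with `Δ_a u = f` and the O1∕O2 remainder `q`:
  `‖u(p₀)‖ ≤ (A ∕ (1 − θ′))·e^{−κ·d(p₀)}`, `A = (F + s_D)·C_g·Σ_{l<3}λ^{−l}∕λ + √(3³∕(c₀ℓ³)·λ⁻³)·E_W`, `θ′ = θ·C_g·Σ_{l<3}λ^{−l}∕λ < 1` — CONDITIONAL on the displayed weight and data letters.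
HONEST SCOPE.  Algebra over (O3d) and O4a; every analytic input is a displayed letter (weight family, growth, decayed data, `E_W`); nothing of the ten EX rows, `hT`, (3.42)∕Thm 3.12 for
print's operators, EX or the crux is proved here.

References: T. Bałaban, CMP **99** (1985) 389–434 [Balaban1985BackgroundPropagators] (Thm 3.1 (3.42) p.397 with `e^{−δ₀d(y,y′)}`, (3.46) p.398, Thm 3.12 p.422); CMP **95** (1984) 17–40
[Balaban1984PropagatorsI] (Prop. 1.1 p.33); S. Agmon (1982) Ch. 1 [folklore].
-/

set_option autoImplicit false

noncomputable section

open scoped Matrix.Norms.L2Operator BigOperators InnerProductSpace ComplexConjugate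

namespace Summit.QuantumFields.YangMills.Theorems.Prop7OneFormPointwiseDecay

open Literature.MathematicalPhysics.QuantumFieldTheory.Balaban1983to89
open Literature.MathematicalPhysics.QuantumFieldTheory.Balaban1983to89.T3ContinuumYM3Torus
open T3SectALandauChart (formComp bgUnits eta eta_pos)
open B4Sect5Torus (TSite)
open B9SectCLatticeCarrier (Bond shift unshift)
open B9Eq311L2Pairing (WL2)
open B9TorusCalculus (torusT)
open B9Eq310Hermitian (deltaPrimeOp)
open B11Eq135Weitzenbock (curvOp)
open B11Eq103H1Complex (BondL2K)
open Summit.QuantumFields.YangMills.Theorems.Prop7SectET3Transport (periodsT3 siteEquiv)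
open Summit.QuantumFields.YangMills.Theorems.Prop7SectET3HilbertLetters (W₂ frobEquiv toL2 DL2 DstarL2)
open Summit.QuantumFields.YangMills.Theorems.Prop7SectET3WilsonHessian (DeltaEta)
open Summit.QuantumFields.YangMills.Theorems.Prop7SectET3GaugeProjector (RS)
open Summit.QuantumFields.YangMills.Theorems.Prop7SectET3CurvedPropagators (laplaceA Qk)
open Summit.QuantumFields.YangMills.Theorems.Prop7OneFormKatoBootstrapDecay (norm_apply_le_of_kato_oneForm_weighted_of_letter)
open Summit.QuantumFields.YangMills.Theorems.Prop7OneFormDecayLetters (ciSup_le_div_of_forall_le_add_mul)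

variable {F : T3Family} {n K : ℕ} {c₀ : ℝ} [Fact (0 < c₀)] {h : n ≤ K} {cB a : ℝ} [Fact (0 < cB)]
  {Δx : GaugeField (F.P K) 0 (Matrix.specialUnitaryGroup (Fin 2) ℂ) → (BondL2K ℂ 3 (periodsT3 F K) c₀ W₂ →ₗ[ℂ] BondL2K ℂ 3 (periodsT3 F K) c₀ W₂)}

/-- ★★★ **THE POINTWISE DECAY OF THE ONE-FORM GREEN's FUNCTION, MODULO LETTERS.**  `Δ_a(U₀)u = f` (ANY background, slot, coupling), `q` the O1∕O2 remainder; `d : Bond → ℝ`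
(distance to the source, in blocks) and a rate `κ`; a family of weights `W p₁ ·` (positive, `W p₁ p₁ = 1`, `λ`-supersolutions of the flat `η⁻²`-stencil on the bond graph) with the
growth letter `e^{κd(p₁)} ≤ C_g·e^{κd(p)}·W p₁ p`; DECAYED data `‖f(p)‖ ≤ F·e^{−κd(p)}`, `‖q(p)‖ ≤ (s_D + θ·S)·e^{−κd(p)}` with `S = ⨆_p ‖u(p)‖e^{κd(p)}`, and
`√(Σ_p c₀‖u(p)‖²∕W p₁ p) ≤ E_W·e^{−κd(p₁)}`; smallness `θ′ := θ·C_g·(Σ_{l<3}λ^{−l})∕λ < 1`.  THEN at every bond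
`‖u(p₀)‖ ≤ (((F + s_D)·C_g·(Σ_{l<3}λ^{−l})∕λ + √(3³∕(c₀ℓ³)·λ⁻³)·E_W) ∕ (1 − θ′))·e^{−κ·d(p₀)}` — print's (3.42) first entry with its exponential factor, for the member's one-form operator.
CONDITIONAL on every displayed letter. [cite: Balaban1985BackgroundPropagators, Thm 3.1 (3.42) p.397, Thm 3.12 p.422; Balaban1984PropagatorsI, Prop. 1.1 p.33] -/
theorem pointwiseDecay_oneForm_of_letters (hnK : n ≤ K) (U₀ : GaugeField (F.P K) 0 (Matrix.specialUnitaryGroup (Fin 2) ℂ))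
    {u f : BondL2K ℂ 3 (periodsT3 F K) c₀ W₂} (hu : laplaceA F n K h c₀ cB a Δx U₀ u = f)
    {q : Bond 3 (periodsT3 F K) → W₂}
    (hq : ∀ p, q p = WL2.equiv ℂ _ W₂ (LinearMap.adjoint (Qk F n K h c₀ cB U₀) (((a : ℝ) : ℂ) • Qk F n K h c₀ cB U₀ u)) p
      - WL2.equiv ℂ _ W₂ (DL2 F n K c₀ U₀ (DstarL2 F n K c₀ U₀ u - RS F n K h c₀ cB U₀ (DstarL2 F n K c₀ U₀ u))) p
      + WL2.equiv ℂ _ W₂ ((Δx U₀ - (DeltaEta F n K c₀ U₀ : BondL2K ℂ 3 (periodsT3 F K) c₀ W₂ →ₗ[ℂ] BondL2K ℂ 3 (periodsT3 F K) c₀ W₂)) u) p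
      + frobEquiv.symm ((eta F n K)⁻¹ • (eta F n K)⁻¹ •
          (deltaPrimeOp (torusT (F.P K) 0) (fun ν x => bgUnits F K U₀ ⟨x, ν⟩) 1 (formComp ((toL2 F K c₀).symm u)) p.2 ((siteEquiv F K).symm p.1)
            - curvOp (torusT (F.P K) 0) (fun ν x => bgUnits F K U₀ ⟨x, ν⟩) (formComp ((toL2 F K c₀).symm u)) p.2 ((siteEquiv F K).symm p.1))))
    (d : Bond 3 (periodsT3 F K) → ℝ) (κ : ℝ)
    (W : Bond 3 (periodsT3 F K) → Bond 3 (periodsT3 F K) → ℝ) {lam : ℝ} (hlam : 0 < lam) (hW : ∀ p₁ p, 0 < W p₁ p)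
    (hsup : ∀ p₁ p, lam * W p₁ p ≤ ∑ j : Fin 3 ⊕ Fin 3, (eta F n K)⁻¹ ^ 2 * (W p₁ p - W p₁ (Sum.elim (fun ν => unshift ν p.1) (fun ν => shift ν p.1) j, p.2)) + 1 * W p₁ p)
    (hW1 : ∀ p₁, W p₁ p₁ = 1)
    {Cg : ℝ} (hCg : 0 ≤ Cg) (hWd : ∀ p₁ p, Real.exp (κ * d p₁) ≤ Cg * Real.exp (κ * d p) * W p₁ p)
    {Fsrc sD θ EW : ℝ} (hFsrc : 0 ≤ Fsrc) (hsD : 0 ≤ sD) (hθ : 0 ≤ θ) (hEW0 : 0 ≤ EW)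
    (hf : ∀ p, ‖WL2.equiv ℂ _ W₂ f p‖ ≤ Fsrc * Real.exp (-(κ * d p)))
    (hqdom : ∀ p, ‖q p‖ ≤ (sD + θ * ⨆ p', ‖WL2.equiv ℂ _ W₂ u p'‖ * Real.exp (κ * d p')) * Real.exp (-(κ * d p)))
    (hEW : ∀ p₁, Real.sqrt (∑ p, c₀ * ‖WL2.equiv ℂ _ W₂ u p‖ ^ 2 / W p₁ p) ≤ EW * Real.exp (-(κ * d p₁)))
    (hsmall : θ * Cg * (∑ l ∈ Finset.range 3, (1 / lam) ^ l) / lam < 1)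
    (p₀ : Bond 3 (periodsT3 F K)) :
    ‖WL2.equiv ℂ _ W₂ u p₀‖
      ≤ (((Fsrc + sD) * Cg * (∑ l ∈ Finset.range 3, (1 / lam) ^ l) / lam
            + Real.sqrt (3 ^ 3 / (c₀ * ((F.L : ℝ) ^ (K - n)) ^ 3) * (lam ^ 3)⁻¹) * EW)
          / (1 - θ * Cg * (∑ l ∈ Finset.range 3, (1 / lam) ^ l) / lam))
        * Real.exp (-(κ * d p₀)) := by
  haveI : Nonempty (Bond 3 (periodsT3 F K)) := ⟨p₀⟩
  -- the weighted sup `S` and its basic properties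
  set g : Bond 3 (periodsT3 F K) → ℝ := fun p => ‖WL2.equiv ℂ _ W₂ u p‖ * Real.exp (κ * d p) with hg
  set S : ℝ := ⨆ p, g p with hS
  have hbdd : BddAbove (Set.range g) := (Set.finite_range _).bddAbove
  have hgS : ∀ p, g p ≤ S := fun p => le_ciSup hbdd p
  have hS0 : 0 ≤ S := le_trans (by positivity : (0 : ℝ) ≤ g p₀) (hgS p₀)
  set Sl : ℝ := ∑ l ∈ Finset.range 3, (1 / lam) ^ l with hSl
  have hSl0 : 0 ≤ Sl := Finset.sum_nonneg fun l _ => by positivity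
  set C₃ : ℝ := Real.sqrt (3 ^ 3 / (c₀ * ((F.L : ℝ) ^ (K - n)) ^ 3) * (lam ^ 3)⁻¹) with hC₃
  have hC₃0 : 0 ≤ C₃ := Real.sqrt_nonneg _
  -- (O3d) at every bond `p₁`, with the decayed data: `g p₁ ≤ A + θ′·S`
  have hkey : ∀ p₁, g p₁ ≤ ((Fsrc + sD) * Cg * Sl / lam + C₃ * EW) + (θ * Cg * Sl / lam) * S := by
    intro p₁
    have he : 0 < Real.exp (-(κ * d p₁)) := Real.exp_pos _
    -- the data domination against `W p₁ ·`
    have hsdef : 0 ≤ (Fsrc + sD + θ * S) * Cg * Real.exp (-(κ * d p₁)) / lam := by positivity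
    have hdata : ∀ p, ‖WL2.equiv ℂ _ W₂ f p‖ + ‖q p‖ ≤ ((Fsrc + sD + θ * S) * Cg * Real.exp (-(κ * d p₁)) / lam) * (lam * W p₁ p) := by
      intro p
      have h1 := hf p
      have h2 := hqdom p
      -- `e^{−κd p} ≤ C_g e^{−κd p₁} W p₁ p`
      have hw : Real.exp (-(κ * d p)) ≤ Cg * Real.exp (-(κ * d p₁)) * W p₁ p := by
        have h3 := hWd p₁ p
        have e1 : Real.exp (-(κ * d p)) = Real.exp (κ * d p₁) * (Real.exp (-(κ * d p₁)) * Real.exp (-(κ * d p))) := by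
          rw [← Real.exp_add, ← Real.exp_add]; congr 1; ring
        have e2 : Cg * Real.exp (-(κ * d p₁)) * W p₁ p = (Cg * Real.exp (κ * d p) * W p₁ p) * (Real.exp (-(κ * d p₁)) * Real.exp (-(κ * d p))) := by
          have : Real.exp (κ * d p) * Real.exp (-(κ * d p)) = 1 := by rw [← Real.exp_add, add_neg_cancel, Real.exp_zero]
          calc Cg * Real.exp (-(κ * d p₁)) * W p₁ p = Cg * Real.exp (-(κ * d p₁)) * W p₁ p * (Real.exp (κ * d p) * Real.exp (-(κ * d p))) := by rw [this, mul_one]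
            _ = _ := by ring
        rw [e1, e2]
        exact mul_le_mul_of_nonneg_right h3 (by positivity)
      have hsum : ‖WL2.equiv ℂ _ W₂ f p‖ + ‖q p‖ ≤ (Fsrc + sD + θ * S) * Real.exp (-(κ * d p)) := by
        have := add_le_add h1 h2; linarith [this]
      have hc : 0 ≤ Fsrc + sD + θ * S := by positivity
      calc ‖WL2.equiv ℂ _ W₂ f p‖ + ‖q p‖ ≤ (Fsrc + sD + θ * S) * Real.exp (-(κ * d p)) := hsum
        _ ≤ (Fsrc + sD + θ * S) * (Cg * Real.exp (-(κ * d p₁)) * W p₁ p) := mul_le_mul_of_nonneg_left hw hc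
        _ = ((Fsrc + sD + θ * S) * Cg * Real.exp (-(κ * d p₁)) / lam) * (lam * W p₁ p) := by field_simp
    have h3d := norm_apply_le_of_kato_oneForm_weighted_of_letter F n K c₀ hnK U₀ hu hq hlam (hW p₁) (hsup p₁) hsdef hdata (hW1 p₁) (hEW p₁)
    -- multiply by `e^{κ d p₁}`
    have hmul := mul_le_mul_of_nonneg_right h3d (Real.exp_pos (κ * d p₁)).le
    have ecancel : Real.exp (-(κ * d p₁)) * Real.exp (κ * d p₁) = 1 := by rw [← Real.exp_add, neg_add_cancel, Real.exp_zero]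
    have e3 : ((Fsrc + sD + θ * S) * Cg * Real.exp (-(κ * d p₁)) / lam * Sl + C₃ * (EW * Real.exp (-(κ * d p₁)))) * Real.exp (κ * d p₁)
        = ((Fsrc + sD) * Cg * Sl / lam + C₃ * EW) + (θ * Cg * Sl / lam) * S := by
      field_simp
      linear_combination ((Fsrc + sD + θ * S) * Cg * Sl + C₃ * EW * lam) * ecancel
    calc g p₁ = ‖WL2.equiv ℂ _ W₂ u p₁‖ * Real.exp (κ * d p₁) := rfl
      _ ≤ ((Fsrc + sD + θ * S) * Cg * Real.exp (-(κ * d p₁)) / lam * Sl + C₃ * (EW * Real.exp (-(κ * d p₁)))) * Real.exp (κ * d p₁) := hmul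
      _ = _ := e3
  -- the fixpoint
  have hfix : S ≤ ((Fsrc + sD) * Cg * Sl / lam + C₃ * EW) / (1 - θ * Cg * Sl / lam) :=
    ciSup_le_div_of_forall_le_add_mul g hsmall hkey
  -- read back at `p₀`
  have hden : 0 < 1 - θ * Cg * Sl / lam := by linarith
  have hA0 : 0 ≤ ((Fsrc + sD) * Cg * Sl / lam + C₃ * EW) / (1 - θ * Cg * Sl / lam) := by positivity
  have hp₀ : ‖WL2.equiv ℂ _ W₂ u p₀‖ = g p₀ * Real.exp (-(κ * d p₀)) := by
    rw [hg]; dsimp only; rw [mul_assoc, ← Real.exp_add, add_neg_cancel, Real.exp_zero, mul_one]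
  rw [hp₀]
  exact mul_le_mul_of_nonneg_right ((hgS p₀).trans hfix) (Real.exp_pos _).le

end Summit.QuantumFields.YangMills.Theorems.Prop7OneFormPointwiseDecay

end
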